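import Literature.AlgebraicGeometry.Frobenioids.ArchimedeanAngularModel
import Literature.AlgebraicGeometry.Frobenioids.DivisorialDescriptionsAPairs
import HarnessLib

/-!
# Frobenioids II, Theorem 3.6 (i), "`(C^Λ)^istr` is of model type, with rational function monoid
# `(Φ^fld)^Λ`" — PROVED for `Λ = ℤ` (`C = C₀ ×_{D₀} D`) over any base

Mochizuki, *The geometry of Frobenioids II*, Kyushu J. Math. **62** (2008) 401–460, §3, Theorem 3.6 (i),
author's kurims text p. 36 [cite: MochizukiFrdII2008, Thm 3.6 (i) p.36]: "The Frobenioid `(C^Λ)^istr` is of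
isotropic, base-trivial, and model type, with rational function monoid naturally isomorphic to
`(Φ^fld)^Λ`" (`Φ^fld : D ↦ Φ^gp(D) × Φ^∡(D)`, p. 36; proof p. 38: "Since `D₀` admits a terminal object, it
thus follows from [Mzk5], Proposition 2.9, (i), that `(C^Λ₀)^istr`, hence also `(C^Λ)^istr` […], is of
model type").

DISCHARGE of the instance `ArchFrd.Thm36i_istrModel_C π` of `ArchimedeanTheoremsInstances.lean` (the case
`Λ = ℤ` — the only one constructible over the present tree; typed reading of "model type": `C^istr` is
equivalent, compatibly with the structure functors to `F_Φ`, to abc-iut-L1-t2's `ModelFrobenioid` of the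
datum `Φ^fld → Φ^gp`): `thm36i_istrModel_C`. The comparison functor sends an isotropic object
`(Spec K, V, A_K; B_D)` with tip `λ` to `(B_D, [log λ] ∈ Φ^gp(B_D))` (`Φ = ℝ_{≥0}` written multiplicatively;
`realToGp : ℝ → (ℝ_{≥0})^gp`), and an arrow `(b, d, c; b_D)` to `(d, b_D, Div, u)` with `Div` its divisor
and `u = ([-log |c|], c/|c|) ∈ Φ^gp × Φ^∡` — relation (d) of [FrdI] Thm. 5.2 (i) is the identity
`d·log λ_X + log(λ_Y/(|c| λ_X^d)) = log λ_Y − log |c|`. Faithful / full / essentially surjective as for `A`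
(`ArchimedeanAngularModel.lean`), plus: the divisor determines `|c|`, every class is a `[log λ]`
(abc-iut-L1-t5's `exists_eq_of_div_of`). Compatible ON THE NOSE with the functors to `F_Φ`.
Everything is PROVED; no statement of the paper is strengthened; nothing here bears on [IUTchIII].
-/

namespace Literature.AlgebraicGeometry.Frobenioids

open CategoryTheory Opposite
open scoped Pointwise NNReal

noncomputable section

universe v u

namespace ArchFrd

/-! ### `ℝ → (ℝ_{≥0})^gp` -/

/-- A nonnegative real as an element of the multiplicatively written monoid `ℝ_{≥0}`.
[cite: MochizukiFrdI2008, §0 p.10] -/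
def nnOf (x : ℝ) (hx : 0 ≤ x) : Multiplicative ℝ≥0 := Multiplicative.ofAdd ⟨x, hx⟩

/-- `[x] := [x⁺] − [x⁻] ∈ (ℝ_{≥0})^gp` for a real number `x`. [cite: MochizukiFrdI2008, §0 p.10] -/
def realToGp (x : ℝ) : Algebra.GrothendieckGroup (Multiplicative ℝ≥0) :=
  Algebra.GrothendieckGroup.of (nnOf (max x 0) (le_max_right _ _)) /
    Algebra.GrothendieckGroup.of (nnOf (max (-x) 0) (le_max_right _ _))

/-- `[a − b] = [a] − [b]` for `a, b ≥ 0`. [cite: MochizukiFrdI2008, §0 p.10] -/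
theorem realToGp_eq_div {x a b : ℝ} (ha : 0 ≤ a) (hb : 0 ≤ b) (h : x = a - b) :
    realToGp x = Algebra.GrothendieckGroup.of (nnOf a ha) / Algebra.GrothendieckGroup.of (nnOf b hb) := by
  rw [realToGp, div_eq_div_iff_mul_eq_mul, ← map_mul, ← map_mul]
  congr 1
  change Multiplicative.ofAdd (⟨max x 0, _⟩ + ⟨b, hb⟩ : ℝ≥0) = Multiplicative.ofAdd (⟨a, ha⟩ + ⟨max (-x) 0, _⟩)
  congr 1
  apply NNReal.eq
  show max x 0 + b = a + max (-x) 0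
  have := max_zero_sub_max_neg_zero_eq_self x
  linarith

/-- `[x] = [x]` for `x ≥ 0` (the class of an element of the monoid). [cite: MochizukiFrdI2008, §0 p.10] -/
theorem realToGp_of_nonneg (x : ℝ) (hx : 0 ≤ x) :
    realToGp x = Algebra.GrothendieckGroup.of (nnOf x hx) := by
  rw [realToGp_eq_div hx le_rfl (sub_zero x).symm]
  change _ / Algebra.GrothendieckGroup.of (Multiplicative.ofAdd (0 : ℝ≥0)) = _
  rw [ofAdd_zero, map_one, div_one]

/-- `[0] = 0`. [cite: MochizukiFrdI2008, §0 p.10] -/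
theorem realToGp_zero : realToGp 0 = 1 := by
  rw [realToGp_of_nonneg 0 le_rfl]
  change Algebra.GrothendieckGroup.of (Multiplicative.ofAdd (0 : ℝ≥0)) = 1
  rw [ofAdd_zero, map_one]

/-- `[x + y] = [x] + [y]`. [cite: MochizukiFrdI2008, §0 p.10] -/
theorem realToGp_add (x y : ℝ) : realToGp (x + y) = realToGp x * realToGp y := by
  rw [realToGp_eq_div (add_nonneg (le_max_right x 0) (le_max_right y 0))
    (add_nonneg (le_max_right (-x) 0) (le_max_right (-y) 0))
    (by have := max_zero_sub_max_neg_zero_eq_self x; have := max_zero_sub_max_neg_zero_eq_self y; linarith)]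
  rw [realToGp, realToGp, div_mul_div_comm, ← map_mul, ← map_mul]
  rfl

/-- `[−x] = −[x]`. [cite: MochizukiFrdI2008, §0 p.10] -/
theorem realToGp_neg (x : ℝ) : realToGp (-x) = (realToGp x)⁻¹ := by
  rw [eq_inv_iff_mul_eq_one, ← realToGp_add, neg_add_cancel, realToGp_zero]

/-- `[x − y] = [x] − [y]`. [cite: MochizukiFrdI2008, §0 p.10] -/
theorem realToGp_sub (x y : ℝ) : realToGp (x - y) = realToGp x / realToGp y := by
  rw [sub_eq_add_neg, realToGp_add, realToGp_neg, div_eq_mul_inv]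

/-- `[n·x] = n·[x]`. [cite: MochizukiFrdI2008, §0 p.10] -/
theorem realToGp_natMul (n : ℕ) (x : ℝ) : realToGp (n * x) = realToGp x ^ n := by
  induction n with
  | zero => rw [Nat.cast_zero, zero_mul, realToGp_zero, pow_zero]
  | succ n ih => rw [Nat.cast_succ, add_mul, one_mul, realToGp_add, ih, pow_succ]

/-- Every class is a `[x]`. [cite: MochizukiFrdI2008, §0 p.10] -/
theorem realToGp_surjective (g : Algebra.GrothendieckGroup (Multiplicative ℝ≥0)) : ∃ x : ℝ, realToGp x = g := by
  obtain ⟨a, b, rfl⟩ := PreFrobenioid.exists_eq_of_div_of g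
  refine ⟨((Multiplicative.toAdd a : ℝ≥0) : ℝ) - ((Multiplicative.toAdd b : ℝ≥0) : ℝ), ?_⟩
  exact realToGp_eq_div (NNReal.coe_nonneg _) (NNReal.coe_nonneg _) rfl

variable {D : Type u} [Category.{v} D] (π : D ⥤ D0)

/-! ### The class of an object and the `Φ^gp`-component of the unit of an arrow -/

/-- Shorthand: the full subcategory `C^istr`. [cite: MochizukiFrdII2008, Thm 3.6 (i) p.36] -/
abbrev CIstr : Type u := (PreFrobenioid.isotropicObjects (C.toElem π)).FullSubcategory

/-- Objects of `C^istr` have naively isotropic regions (Ex. 3.3 (ii), abc-iut-L1-t6).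
[cite: MochizukiFrdII2008, Ex 3.3 (ii) p.28] -/
theorem CIstr.isNaivelyIsotropic (X : CIstr π) : X.obj.fst.IsNaivelyIsotropic :=
  (Ex33ii_isotropic_iff_holds π X.obj).1 X.property

/-- The class `[log tip(X)] ∈ Φ^gp(X_D)` of an object of `C`. [cite: MochizukiFrdII2008, Thm 3.6 (i) p.36] -/
def clsOf (X : C π) : Algebra.GrothendieckGroup ((Φ π).obj (op X.snd)) := realToGp (Real.log X.fst.tip)

/-- The `Φ^gp`-component `[−log |c|]` of the unit of an arrow of `C`. [cite: MochizukiFrdII2008, Thm 3.6 (i) p.36] -/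
def gpUnitOf {X Y : C π} (φ : X ⟶ Y) : Algebra.GrothendieckGroup ((Φ π).obj (op X.snd)) :=
  realToGp (-Real.log ‖(C0.scalar φ.fst : ℂ)‖)

/-- `[−log |1|] = 0`. [cite: MochizukiFrdII2008, Thm 3.6 (i) p.36] -/
theorem gpUnitOf_id (X : C π) : gpUnitOf π (𝟙 X) = 1 := by
  change realToGp (-Real.log ‖((1 : ℂˣ) : ℂ)‖) = 1
  rw [Units.val_one, norm_one, Real.log_one, neg_zero, realToGp_zero]

/-- The composite law of the `Φ^gp`-components: `|ι(c_φ) · c_ψ^{d_φ}| = |c_φ| |c_ψ|^{d_φ}`.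
[cite: MochizukiFrdII2008, Thm 3.6 (i) p.36] -/
theorem gpUnitOf_comp {X Y Z : C π} (ψ : X ⟶ Y) (φ : Y ⟶ Z) :
    gpUnitOf π (ψ ≫ φ) =
      (show Algebra.GrothendieckGroup ((Φ π).obj (op X.snd)) from gpUnitOf π (X := Y) (Y := Z) φ) *
        gpUnitOf π ψ ^ (C0.degFr φ.fst : ℕ) := by
  change realToGp (-Real.log ‖(((C0.Base ψ.fst).act (C0.scalar φ.fst) * C0.scalar ψ.fst ^ (C0.degFr φ.fst : ℕ)
    : ℂˣ) : ℂ)‖) = realToGp (-Real.log ‖(C0.scalar φ.fst : ℂ)‖) * realToGp (-Real.log ‖(C0.scalar ψ.fst : ℂ)‖) ^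
      (C0.degFr φ.fst : ℕ)
  rw [Units.val_mul, norm_mul, Units.val_pow_eq_pow_val, norm_pow, D0.norm_galAct,
    Real.log_mul (norm_ne_zero_iff.mpr (C0.scalar φ.fst).ne_zero)
      (pow_ne_zero _ (norm_ne_zero_iff.mpr (C0.scalar ψ.fst).ne_zero)),
    Real.log_pow, neg_add, realToGp_add, ← mul_neg, realToGp_natMul]

/-- Pull-backs of `Φ^gp = (ℝ_{≥0}|_D)^gp` are identities (constant monoid).
[cite: MochizukiFrdII2008, Ex 3.3 (i) p.28] -/
theorem pullGp_const {A A' : D} (b : A ⟶ A') (c : Algebra.GrothendieckGroup ((Φ π).obj (op A'))) :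
    pullGp (Φ π) b c = c := by
  obtain ⟨x, y, rfl⟩ := PreFrobenioid.exists_eq_of_div_of c
  rw [map_div, pullGp_of, pullGp_of]
  rfl

/-- `Φ^gp(f)` is the identity (constant monoid), in found's `gpMap` spelling (the maps of
`groupificationFunctor`). [cite: MochizukiFrdII2008, Ex 3.3 (i) p.28] -/
theorem gpMap_map_const {A A' : D} (b : A ⟶ A') (g : Algebra.GrothendieckGroup ((Φ π).obj (op A'))) :
    gpMap ((Φ π).map b.op).hom g = (show Algebra.GrothendieckGroup ((Φ π).obj (op A)) from g) := by
  obtain ⟨x, y, rfl⟩ := PreFrobenioid.exists_eq_of_div_of g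
  rw [map_div, gpMap_of, gpMap_of]
  rfl

/-- The datum `Div_B = pr₁ : Φ^fld → Φ^gp` with its codomain spelled `monoidGp` (t2's model-Frobenioid
convention; the same natural transformation as `fieldMonoidToGp`). [cite: MochizukiFrdII2008, Thm 3.6 (i) p.36] -/
def fieldDivB : fieldMonoid (Φ π) π ⟶ monoidGp (Φ π) := fieldMonoidToGp (Φ π) π

/-- The model Frobenioid of `Φ^fld → Φ^gp` (= `fieldModel π` of the instances file, with `Div_B` spelled
`fieldDivB`). [cite: MochizukiFrdII2008, Thm 3.6 (i) p.36] -/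
abbrev fieldModel' : Type u := ModelFrobenioid (Φ π) (fieldMonoid (Φ π) π) (fieldDivB π)

/-! ### The comparison functor `C^istr → model(Φ^fld → Φ^gp)` -/

/-- The object part `X ↦ (X_D, [log tip(X)])` (an `abbrev`, so that its base is reducibly `X_D`).
[cite: MochizukiFrdII2008, Thm 3.6 (i) p.36] -/
abbrev istrToFieldObj (X : CIstr π) : fieldModel' π := ⟨X.obj.snd, clsOf π X.obj⟩

/-- The divisor of an arrow of `C^istr`, as an element of `Φ(X_D)`. [cite: MochizukiFrdII2008, Ex 3.3 (i) p.28] -/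
abbrev divOf {X Y : CIstr π} (f : X ⟶ Y) : (Φ π).obj (op X.obj.snd) := PreFrobenioid.Div (C.toElem π) f.hom

/-- The unit `([−log |c|], u) ∈ Φ^fld(X_D)` of an arrow of `C^istr`. [cite: MochizukiFrdII2008, Thm 3.6 (i) p.36] -/
abbrev fldUnitOf {X Y : CIstr π} (f : X ⟶ Y) : (fieldMonoid (Φ π) π).obj (op X.obj.snd) :=
  (gpUnitOf π f.hom, unitOf π f.hom)

/-- Relation (d) of [FrdI] Thm. 5.2 (i) for the image of an arrow of `C^istr`, in `(ℝ_{≥0})^gp`: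
`d·[log λ_X] + [Div φ] = [log λ_Y] + [−log |c|]`. [cite: MochizukiFrdI2008, Thm. 5.2(i) p.100] -/
theorem fieldModel_rel_plain {X Y : CIstr π} (f : X ⟶ Y) :
    realToGp (Real.log X.obj.fst.tip) ^ (C0.degFr f.hom.fst : ℕ) * Algebra.GrothendieckGroup.of (C0.div f.hom.fst) =
      realToGp (Real.log Y.obj.fst.tip) * realToGp (-Real.log ‖(C0.scalar f.hom.fst : ℂ)‖) := by
  have hdiv : Algebra.GrothendieckGroup.of (C0.div f.hom.fst) = realToGp (Real.log (C0.ratio f.hom.fst)) :=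
    (realToGp_of_nonneg _ (Real.log_nonneg (C0.one_le_ratio _))).symm
  rw [hdiv, ← realToGp_natMul, ← realToGp_add, ← realToGp_add]
  congr 1
  have hc : 0 < ‖(C0.scalar f.hom.fst : ℂ)‖ := norm_pos_iff.mpr (C0.scalar f.hom.fst).ne_zero
  have hX : 0 < X.obj.fst.tip := X.obj.fst.tip_pos
  have hY : 0 < Y.obj.fst.tip := Y.obj.fst.tip_pos
  unfold C0.ratio
  rw [Real.log_div hY.ne' (mul_pos hc (pow_pos hX _)).ne', Real.log_mul hc.ne' (pow_pos hX _).ne', Real.log_pow]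
  ring

/-- The morphism part `(b, d, c; b_D) ↦ (d, b_D, Div, ([−log |c|], u))`. [cite: MochizukiFrdII2008, Thm 3.6 (i) p.36] -/
def istrToFieldMap {X Y : CIstr π} (f : X ⟶ Y) : istrToFieldObj π X ⟶ istrToFieldObj π Y where
  degFr := C0.degFr f.hom.fst
  base := f.hom.snd
  div := divOf π f
  unit := fldUnitOf π f
  rel := by
    rw [pullGp_const]
    exact fieldModel_rel_plain π f

/-- **The comparison functor `C^istr → model(Φ^fld → Φ^gp)`** of Thm. 3.6 (i), `Λ = ℤ`.
[cite: MochizukiFrdII2008, Thm 3.6 (i) p.36] -/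
def istrToField : CIstr π ⥤ fieldModel' π where
  obj := istrToFieldObj π
  map := istrToFieldMap π
  map_id X := by
    refine ModelFrobenioid.hom_ext rfl rfl (PreFrobenioid.div_id (C.toElem π) X.obj) ?_
    exact Prod.ext (gpUnitOf_id π X.obj) (unitOf_id π X.obj)
  map_comp f g := by
    refine ModelFrobenioid.hom_ext (mul_comm _ _) rfl (PreFrobenioid.div_comp (C.toElem π) f.hom g.hom) ?_
    refine Prod.ext ?_ (unitOf_comp π f.hom g.hom)
    change gpUnitOf π (f.hom ≫ g.hom) =
      gpMap ((Φ π).map f.hom.snd.op).hom (gpUnitOf π g.hom) * gpUnitOf π f.hom ^ (C0.degFr g.hom.fst : ℕ)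
    rw [gpUnitOf_comp, gpMap_map_const]

/-! ### Accessors for a morphism of the model -/

section Acc

variable {X Y : CIstr π} (m : istrToFieldObj π X ⟶ istrToFieldObj π Y)

/-- The unit `u ∈ O^×_{π(X_D)}` of `m` (second component of `u_m ∈ Φ^fld`). [cite: MochizukiFrdII2008, Thm 3.6 (i) p.36] -/
def fmUnit : ↥(D0.unitScalars (π.obj X.obj.snd)) := (ModelFrobenioid.unit m).2

/-- The `Φ^gp`-component of `u_m`. [cite: MochizukiFrdII2008, Thm 3.6 (i) p.36] -/
def fmGp : Algebra.GrothendieckGroup (Multiplicative ℝ≥0) := (ModelFrobenioid.unit m).1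

/-- The divisor of `m` as a nonnegative real. [cite: MochizukiFrdII2008, Thm 3.6 (i) p.36] -/
def fmDiv : ℝ≥0 := Multiplicative.toAdd (show Multiplicative ℝ≥0 from ModelFrobenioid.div m)

end Acc

/-! ### Faithful -/

/-- Two arrows of `C` between objects with naively isotropic regions, with the same degree, `D`-component,
divisor and unit coincide. [cite: MochizukiFrdII2008, Thm 3.6 (i) p.36] -/
theorem eq_of_div_eq_of_unitOf_eq {X Y : C π} {φ ψ : X ⟶ Y} (hd : C0.degFr φ.fst = C0.degFr ψ.fst)
    (hs : φ.snd = ψ.snd) (hdiv : C0.div φ.fst = C0.div ψ.fst) (hu : unitOf π φ = unitOf π ψ) : φ = ψ := by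
  have hbase : PreFrobenioid.Base C0.toElem φ.fst = PreFrobenioid.Base C0.toElem ψ.fst := by
    refine (cancel_mono Y.e.hom).1 ?_
    rw [PreFrobenioid.FiberProduct.hom_w, PreFrobenioid.FiberProduct.hom_w, hs]
  refine CFP.hom_ext (C0.hom_ext hbase hd ?_) hs
  apply eq_of_unitPart_eq_of_absHom_eq
  · have h := congrArg (fun w : ↥(D0.unitScalars (π.obj X.snd)) =>
      D0.galAct (D0.Hom.twists X.iso.inv) (w : ℂˣ)) hu
    simp only [coe_unitOf, D0.galAct_galAct] at h
    exact Subtype.ext h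
  · apply Subtype.ext
    rw [coe_absHom, coe_absHom]
    have hr : C0.ratio φ.fst = C0.ratio ψ.fst := by
      have h := congrArg (fun m => ((Multiplicative.toAdd m : ℝ≥0) : ℝ)) hdiv
      simp only [C0.coe_toAdd_div] at h
      exact Real.log_injOn_pos (C0.ratio_pos _) (C0.ratio_pos _) h
    unfold C0.ratio at hr
    rw [hd] at hr
    have hY : 0 < Y.fst.tip := Y.fst.tip_pos
    have hT : 0 < X.fst.tip ^ (C0.degFr ψ.fst : ℕ) := pow_pos X.fst.tip_pos _
    have hφ : 0 < ‖(C0.scalar φ.fst : ℂ)‖ := norm_pos_iff.mpr (C0.scalar φ.fst).ne_zero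
    have hψ : 0 < ‖(C0.scalar ψ.fst : ℂ)‖ := norm_pos_iff.mpr (C0.scalar ψ.fst).ne_zero
    field_simp at hr
    nlinarith [hr, hY, hT, hφ, hψ, mul_pos hφ hT, mul_pos hψ hT]

/-- The comparison functor is faithful. [cite: MochizukiFrdII2008, Thm 3.6 (i) p.36] -/
theorem faithful_istrToField : (istrToField π).Faithful where
  map_injective {X Y} f g h := by
    apply ObjectProperty.hom_ext
    have hdiv : PreFrobenioid.Div (C.toElem π) f.hom = PreFrobenioid.Div (C.toElem π) g.hom :=
      congrArg ModelFrobenioid.div h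
    exact eq_of_div_eq_of_unitOf_eq π (congrArg ModelFrobenioid.degFr h) (congrArg ModelFrobenioid.baseMap h)
      hdiv (congrArg (fmUnit π) h)

/-! ### Full -/

section Full

variable {X Y : CIstr π} (m : istrToFieldObj π X ⟶ istrToFieldObj π Y)

/-- The absolute value forced by degree and divisor: `tip(Y)/(tip(X)^d · e^{Div})`.
[cite: MochizukiFrdII2008, Thm 3.6 (i) p.36] -/
def fPreRatio : PosReal :=
  ⟨Y.obj.fst.tip / (X.obj.fst.tip ^ (ModelFrobenioid.degFr m : ℕ) * Real.exp (fmDiv π m)),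
    div_pos Y.obj.fst.tip_pos (mul_pos (pow_pos X.obj.fst.tip_pos _) (Real.exp_pos _))⟩

/-- The scalar of the preimage. [cite: MochizukiFrdII2008, Thm 3.6 (i) p.36] -/
def fPreScalar : ℂˣ :=
  ofPosReal ℂ (fPreRatio π m) * D0.galAct (D0.Hom.twists X.obj.iso.hom) (fmUnit π m : ℂˣ)

/-- The scalar of the preimage is a scalar of the base field of `X`. [cite: MochizukiFrdII2008, Ex 3.3 (i) p.27] -/
theorem fPreScalar_mem : fPreScalar π m ∈ D0.scalars X.obj.fst.base :=
  mul_mem (ofPosReal_mem_scalars _ _) (C0.act_mem_scalars X.obj.iso.hom (fmUnit π m).2.1)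

/-- The norm of the preimage scalar. [cite: MochizukiFrdII2008, Thm 3.6 (i) p.36] -/
theorem norm_fPreScalar : ‖(fPreScalar π m : ℂ)‖ =
    Y.obj.fst.tip / (X.obj.fst.tip ^ (ModelFrobenioid.degFr m : ℕ) * Real.exp (fmDiv π m)) := by
  rw [fPreScalar, Units.val_mul, norm_mul, C0.norm_coe_ofPosReal, D0.norm_galAct, (fmUnit π m).2.2, mul_one]
  rfl

/-- The `C₀`-component of the preimage. [cite: MochizukiFrdII2008, Thm 3.6 (i) p.36] -/
def fPreFst : X.obj.fst ⟶ Y.obj.fst :=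
  C0.homOfNorm _ _ (X.obj.e.hom ≫ π.map (ModelFrobenioid.baseMap m) ≫ Y.obj.e.inv)
    (ModelFrobenioid.degFr m) (fPreScalar π m) (fPreScalar_mem π m) (CIstr.isNaivelyIsotropic π Y)
    (by
      have hY : 0 < Y.obj.fst.tip := Y.obj.fst.tip_pos
      have hT : 0 < X.obj.fst.tip ^ (ModelFrobenioid.degFr m : ℕ) := pow_pos X.obj.fst.tip_pos _
      have he : 1 ≤ Real.exp (fmDiv π m) := Real.one_le_exp (fmDiv π m).2
      rw [norm_fPreScalar, div_mul_eq_mul_div, mul_comm (X.obj.fst.tip ^ _) (Real.exp _),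
        mul_div_mul_right _ _ hT.ne']
      exact div_le_self hY.le he)

/-- The preimage in `C`. [cite: MochizukiFrdII2008, Thm 3.6 (i) p.36] -/
def fPreHom : X.obj ⟶ Y.obj where
  fst := fPreFst π m
  snd := ModelFrobenioid.baseMap m
  w := by
    change (X.obj.e.hom ≫ π.map (ModelFrobenioid.baseMap m) ≫ Y.obj.e.inv) ≫ Y.obj.e.hom =
      X.obj.e.hom ≫ π.map (ModelFrobenioid.baseMap m)
    rw [Category.assoc, Category.assoc, Iso.inv_hom_id, Category.comp_id]

/-- The ratio of the preimage is `e^{Div}`. [cite: MochizukiFrdII2008, Thm 3.6 (i) p.36] -/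
theorem ratio_fPreHom : C0.ratio (fPreHom π m).fst = Real.exp (fmDiv π m) := by
  change Y.obj.fst.tip / (‖(fPreScalar π m : ℂ)‖ * X.obj.fst.tip ^ (ModelFrobenioid.degFr m : ℕ)) = _
  rw [norm_fPreScalar]
  have hY : Y.obj.fst.tip ≠ 0 := Y.obj.fst.tip_pos.ne'
  have hT : X.obj.fst.tip ^ (ModelFrobenioid.degFr m : ℕ) ≠ 0 := (pow_pos X.obj.fst.tip_pos _).ne'
  have he : Real.exp (fmDiv π m) ≠ 0 := (Real.exp_pos _).ne'
  field_simp

/-- The divisor of the preimage is the prescribed one. [cite: MochizukiFrdII2008, Thm 3.6 (i) p.36] -/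
theorem div_fPreHom : PreFrobenioid.Div (C.toElem π) (fPreHom π m) = ModelFrobenioid.div m := by
  change C0.div (fPreHom π m).fst = _
  apply Multiplicative.toAdd.injective
  apply NNReal.eq
  rw [C0.coe_toAdd_div, ratio_fPreHom, Real.log_exp]
  rfl

/-- The unit of the preimage is the prescribed one. [cite: MochizukiFrdII2008, Thm 3.6 (i) p.36] -/
theorem unitOf_fPreHom : unitOf π (fPreHom π m) = fmUnit π m := by
  apply Subtype.ext
  rw [coe_unitOf]
  change D0.galAct _ ((unitPart ℂ (fPreScalar π m)) : ℂˣ) = _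
  rw [fPreScalar, unitPart_ofPosReal_mul, coe_unitPart_galAct,
    UnitStab.unitPart_eq_of_norm_eq_one _ (fmUnit π m).2.2, twists_iso_inv, D0.galAct_galAct]

/-- The `Φ^gp`-component of the unit of the preimage is the prescribed one (it is forced by relation (d)).
[cite: MochizukiFrdII2008, Thm 3.6 (i) p.36] -/
theorem gpUnitOf_fPreHom : gpUnitOf π (fPreHom π m) = fmGp π m := by
  -- relation (d) for `m`, in `(ℝ_{≥0})^gp`: `[log λ_X]^d · [Div] = [log λ_Y] · g`
  have hrel : realToGp (Real.log X.obj.fst.tip) ^ (ModelFrobenioid.degFr m : ℕ) *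
      Algebra.GrothendieckGroup.of (show Multiplicative ℝ≥0 from ModelFrobenioid.div m) =
      realToGp (Real.log Y.obj.fst.tip) * fmGp π m := by
    have h := ModelFrobenioid.rel m
    rw [pullGp_const] at h
    exact h
  have hδ : Algebra.GrothendieckGroup.of (show Multiplicative ℝ≥0 from ModelFrobenioid.div m) =
      realToGp (fmDiv π m) := (realToGp_of_nonneg _ (fmDiv π m).2).symm
  rw [hδ, ← realToGp_natMul, ← realToGp_add] at hrel
  have hg : fmGp π m = realToGp (-Real.log Y.obj.fst.tip +
      (((ModelFrobenioid.degFr m : ℕ) : ℝ) * Real.log X.obj.fst.tip + (fmDiv π m : ℝ))) := by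
    rw [realToGp_add, realToGp_neg, eq_inv_mul_iff_mul_eq]; exact hrel.symm
  rw [hg]
  change realToGp (-Real.log ‖(fPreScalar π m : ℂ)‖) = _
  rw [norm_fPreScalar]
  congr 1
  have hX : 0 < X.obj.fst.tip := X.obj.fst.tip_pos
  have hY : 0 < Y.obj.fst.tip := Y.obj.fst.tip_pos
  rw [Real.log_div hY.ne' (mul_pos (pow_pos hX _) (Real.exp_pos _)).ne',
    Real.log_mul (pow_pos hX _).ne' (Real.exp_pos _).ne', Real.log_pow, Real.log_exp]
  ring

/-- The functor maps the preimage to `m`. [cite: MochizukiFrdII2008, Thm 3.6 (i) p.36] -/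
theorem map_fPreHom : (istrToField π).map (ObjectProperty.homMk (fPreHom π m)) = m :=
  ModelFrobenioid.hom_ext rfl rfl (div_fPreHom π m) (Prod.ext (gpUnitOf_fPreHom π m) (unitOf_fPreHom π m))

end Full

/-- The comparison functor is full. [cite: MochizukiFrdII2008, Thm 3.6 (i) p.36] -/
theorem full_istrToField : (istrToField π).Full :=
  ⟨fun m => ⟨ObjectProperty.homMk (fPreHom π m), map_fPreHom π m⟩⟩

/-! ### Essentially surjective -/

/-- The isotropic object over `B ∈ Ob(D)` with tip `e^x`, as an object of `C^istr`.
[cite: MochizukiFrdII2008, Thm 3.6 (i) p.36] -/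
def expObj (B : D) (x : ℝ) : CIstr π :=
  ⟨⟨⟨π.obj B, AngularRegion.isotropicOfTip ⟨Real.exp x, Real.exp_pos x⟩,
      fun _ => AngularRegion.isIsotropic_isotropicOfTip _⟩, B, Iso.refl _⟩,
    (Ex33ii_isotropic_iff_holds π _).2 (AngularRegion.isIsotropic_isotropicOfTip _)⟩

/-- The class of `expObj B x` is `[x]`. [cite: MochizukiFrdII2008, Thm 3.6 (i) p.36] -/
theorem clsOf_expObj (B : D) (x : ℝ) : clsOf π (expObj π B x).obj = realToGp x := by
  change realToGp (Real.log (Real.exp x)) = _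
  rw [Real.log_exp]

/-- The comparison functor is essentially surjective (every class is a `[log λ]`).
[cite: MochizukiFrdII2008, Thm 3.6 (i) p.36] -/
theorem essSurj_istrToField : (istrToField π).EssSurj where
  mem_essImage W := by
    obtain ⟨B, α⟩ := W
    obtain ⟨x, hx⟩ := realToGp_surjective α
    refine ⟨expObj π B x, ⟨eqToIso ?_⟩⟩
    change (⟨B, clsOf π (expObj π B x).obj⟩ : fieldModel' π) = ⟨B, α⟩
    rw [clsOf_expObj, hx]

/-- The comparison functor is an equivalence. [cite: MochizukiFrdII2008, Thm 3.6 (i) p.36] -/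
theorem isEquivalence_istrToField : (istrToField π).IsEquivalence where
  faithful := faithful_istrToField π
  full := full_istrToField π
  essSurj := essSurj_istrToField π

/-- Compatibility with the structure functors to `F_Φ`, ON THE NOSE. [cite: MochizukiFrdII2008, Thm 3.6 (i) p.36] -/
theorem istrToField_comp_toElem :
    istrToField π ⋙ ModelFrobenioid.toElem (Φ π) (fieldMonoid (Φ π) π) (fieldDivB π) =
      istr (C.toElem π) := rfl

/-- **Theorem 3.6 (i), "`(C^Λ)^istr` is of model type, with rational function monoid `(Φ^fld)^Λ`", for
`Λ = ℤ`** (PROVED over any base `π : D → D₀`): `C^istr` is equivalent to the model Frobenioid of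
`Φ^fld → Φ^gp`, compatibly with the structure functors. [cite: MochizukiFrdII2008, Thm 3.6 (i) p.36] -/
theorem thm36i_istrModel_C : Thm36i_istrModel_C π := by
  haveI := isEquivalence_istrToField π
  exact ⟨(istrToField π).asEquivalence, ⟨eqToIso (istrToField_comp_toElem π)⟩⟩

/-- `Thm36i_istrModel_C π` — Thm. 3.6 (i), "`(C^Λ)^istr` is of model type" at `Λ = ℤ`, over any base `π` — holds: the named-fact instance of `ArchimedeanTheoremsInstances.lean` is
the theorem `thm36i_istrModel_C` just proved; this alias records the discharge under the tree's exact naming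
convention `X_holds` (D-0026 bookkeeping, flt-inv gen 65: proof term = the existing theorem; nothing else
edited; the ledger listed the fact as unproved, `ledger fact claim` GRANTED 2026-08-28T09:4xZ). [cite: MochizukiFrdII2008, Thm 3.6 (i) p.36] -/
theorem Thm36i_istrModel_C_holds : Thm36i_istrModel_C π := thm36i_istrModel_C π

end ArchFrd

end

end Literature.AlgebraicGeometry.Frobenioids
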